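import Literature.NumberTheory.PAdicHodge.UnramifiedWittFixedPoints
import Mathlib.RingTheory.AdjoinRoot
import HarnessLib

/-!
# Eisenstein root data over `W(k_F)`: `E ∈ W(k_F)[X]` Eisenstein, `π ∈ F` a root, `‖π‖ ^ e = ‖p‖`

Topic `Literature/NumberTheory/PAdicHodge`; uses `UnramifiedWittFixedPoints` (`W(k_F) = W(k̄)^{Γ_F} = wittFixed F p`,
`wittFixedToF : W(k_F) → F`, `wittFixedToIntC : W(k_F) → 𝒪_{ℂ_F}`), `CompletedAlgClosure` (`ℂ_F`, `integerC F`).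

This is the residue-degree-`f` version of `EisensteinRootDatum` (which has `ℤ_p`-coefficients and so describes
only the totally ramified subextension `ℚ_p(ϖ) ⊆ F`).  An EISENSTEIN ROOT DATUM OVER `W(k_F)`,
`D = (E, π) : EisensteinRootW F p hp`, is a monic polynomial `E ∈ W(k_F)[X]` (coefficients in the `Γ_F`-fixed Witt
vectors) which is Eisenstein at `p` — non-leading coefficients divisible by `p`, constant coefficient `p` times a
unit — together with a root `π ∈ F` (along `wittFixedToF : W(k_F) → F`).  Every `p`-adic field `F` has such a
datum with `π` ANY uniformizer and `e = e(F/ℚ_p)` (`𝒪_F = W(k_F)[π]`, Serre, *Corps locaux* I §6 Prop. 18); it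
is the input of the ramified Fontaine ring `𝔸_inf(F)[X]/(E) = 𝒪_F ⊗_{W(k_F)} 𝔸_inf(F)` for GENERAL `F`
(sequel `AinfRamifiedWitt`), the ring carrying Fontaine's element of the Lubin–Tate Tate module when `f ≥ 2`.

* §1 `EisensteinRootW`; the degree `e ≥ 1` (`deg_pos`); the coefficients (`dvd_coeff`, `exists_coeff_zero_eq_mul_unit`).
* §2 the root in `ℂ_F`: **`‖π‖ < 1`** and **`‖π‖ ^ e = ‖p‖`** (ultrametric domination of the constant term;
  `norm_algebraMap_unif_lt_one`, `norm_algebraMap_unif_pow`), `unifC : 𝒪_{ℂ_F}`, fixed by `Γ_F`, `E(π) = 0` along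
  `W(k_F) → 𝒪_{ℂ_F}`.
* §3 the coefficient ring `𝒪_D = W(k_F)[X]/(E) = AdjoinRoot E` (`Coeff`), `𝒪_D → F` (`Coeff.toF`) with values in
  `𝒪_F` (`Coeff.toInt`).

Definitions (reviewed): `EisensteinRootW`, `EisensteinRootW.deg`, `.unif`, `.unifC`, `.Coeff`, `.Coeff.toF`, `.Coeff.toInt`.
No named facts, no `sorry`, no instances.  Nothing about `𝒪_F = W(k_F)[π]` is claimed here.

## References
* [SerreLocalFields1979] J.-P. Serre, *Local Fields* (GTM 67, 1979), Ch. I §6 (Eisenstein polynomials and totally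
  ramified extensions, Prop. 17–18), Ch. II §5 (`W(k_F) = 𝒪_{F₀}`).
* [FarguesFontaine2018] L. Fargues, J.-M. Fontaine, *Courbes et fibrés vectoriels en théorie de Hodge p-adique*,
  Astérisque 406 (2018), §1.2 (ramified Witt vectors `𝒪_E ⊗_{W(k)} W`).
-/

noncomputable section

open ValuativeRel Field Ideal WittVector Polynomial IsLocalRing

namespace Literature.NumberTheory.PAdicHodge

open Literature.NumberTheory.GaloisRepresentations
open Literature.NumberTheory.GaloisRepresentations.IsNonarchimedeanLocalField

variable {F : Type} [Field F] [ValuativeRel F] [TopologicalSpace F] [IsNonarchimedeanLocalField F]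
  [CharZero F] {p : ℕ} [Fact p.Prime]

/-! ## §1 Eisenstein root data over `W(k_F)` -/

variable (F p) in
/-- **An Eisenstein root datum over `W(k_F)` for the `p`-adic field `F`**: a monic polynomial `E ∈ W(k_F)[X]`
(`W(k_F) = W(k̄)^{Γ_F}`, tree `wittFixed`), Eisenstein at `p` (all non-leading coefficients in `p W(k_F)`, constant
coefficient `p` times a unit), together with a root `π ∈ F` along `W(k_F) → F`.  Then `W(k_F)[π] ⊆ 𝒪_F` is the ring of
integers of the totally ramified extension `F₀(π)/F₀` of degree `e = deg E` of the maximal unramified subfield `F₀`,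
with uniformizer `π`. [cite: SerreLocalFields1979, Ch. I §6 Prop. 17–18] -/
structure EisensteinRootW (hp : valuation F p < 1) : Type where
  /-- the Eisenstein polynomial `E ∈ W(k_F)[X]` -/
  poly : (wittFixed F p)[X]
  /-- `E` is monic -/
  monic : poly.Monic
  /-- the non-leading coefficients are divisible by `p` -/
  dvd_coeff' : ∀ i < poly.natDegree, (p : wittFixed F p) ∣ poly.coeff i
  /-- the constant coefficient is `p` times a unit -/
  exists_coeff_zero : ∃ u : (wittFixed F p)ˣ, poly.coeff 0 = (p : wittFixed F p) * u
  /-- the root `π ∈ F` -/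
  unif : F
  /-- `E(π) = 0` -/
  eval₂_unif : poly.eval₂ (wittFixedToF F p hp) unif = 0

namespace EisensteinRootW

variable {hp : valuation F p < 1} (D : EisensteinRootW F p hp)

/-- **The degree `e = deg E`** (the ramification index of `F₀(π)/F₀`). [cite: SerreLocalFields1979, Ch. I §6 Prop. 18] -/
def deg : ℕ := D.poly.natDegree

/-- `e = deg E`. [cite: SerreLocalFields1979, Ch. I §6 Prop. 18] -/
theorem deg_def : D.deg = D.poly.natDegree := rfl

/-- **`e ≥ 1`**: a monic polynomial with a root is not constant. [cite: SerreLocalFields1979, Ch. I §6 Prop. 17] -/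
theorem deg_pos : 0 < D.deg := by
  rw [deg_def, Nat.pos_iff_ne_zero]
  intro h0
  have h1 : D.poly = 1 := (Polynomial.Monic.natDegree_eq_zero D.monic).1 h0
  have h := D.eval₂_unif
  rw [h1, eval₂_one] at h
  exact one_ne_zero h

/-- The non-leading coefficients of `E` are divisible by `p` (Eisenstein). [cite: SerreLocalFields1979, Ch. I §6 Prop. 17] -/
theorem dvd_coeff {i : ℕ} (hi : i < D.deg) : (p : wittFixed F p) ∣ D.poly.coeff i := D.dvd_coeff' i hi

/-- The constant coefficient of `E` is `p` times a unit of `W(k_F)` (Eisenstein). [cite: SerreLocalFields1979, Ch. I §6 Prop. 17] -/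
theorem exists_coeff_zero_eq_mul_unit : ∃ u : (wittFixed F p)ˣ, D.poly.coeff 0 = (p : wittFixed F p) * u :=
  D.exists_coeff_zero

/-- The leading coefficient is `1`. [cite: SerreLocalFields1979, Ch. I §6 Prop. 17] -/
theorem coeff_deg : D.poly.coeff D.deg = 1 := D.monic

/-! ## §2 The root in `ℂ_F` -/

/-- `π^e = -(c₀ + c₁π + ⋯ + c_{e-1}π^{e-1})` in `ℂ_F`. [cite: SerreLocalFields1979, Ch. I §6 Prop. 17] -/
theorem algebraMap_unif_pow_deg :
    algebraMap F (CompletedAlgClosure F) D.unif ^ D.deg =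
      - ∑ i ∈ Finset.range D.deg, algebraMap F (CompletedAlgClosure F) (wittFixedToF F p hp (D.poly.coeff i)) *
          algebraMap F (CompletedAlgClosure F) D.unif ^ i := by
  have h := congrArg (algebraMap F (CompletedAlgClosure F)) D.eval₂_unif
  rw [map_zero, Polynomial.eval₂_eq_sum_range, map_sum, Finset.sum_range_succ] at h
  have hlead : D.poly.coeff D.poly.natDegree = 1 := D.monic
  rw [hlead, map_one, one_mul, map_pow] at h
  rw [deg_def, eq_neg_iff_add_eq_zero, add_comm]
  simpa only [map_mul, map_pow] using h

/-- **`‖π‖ < 1` in `ℂ_F`**: a root of an Eisenstein polynomial is topologically nilpotent (ultrametric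
inequality: `‖π‖ ≥ 1` would give `‖π‖^e ≤ ‖p‖ ‖π‖^{e-1} < ‖π‖^e`). [cite: SerreLocalFields1979, Ch. I §6 Prop. 17] -/
theorem norm_algebraMap_unif_lt_one : ‖algebraMap F (CompletedAlgClosure F) D.unif‖ < 1 := by
  set x := algebraMap F (CompletedAlgClosure F) D.unif with hx
  by_contra hge
  rw [not_lt] at hge
  have hp1 : ‖(p : CompletedAlgClosure F)‖ < 1 := norm_natCast_C_lt_one hp
  have he := D.deg_pos
  have hbound : ‖x ^ D.deg‖ ≤ ‖(p : CompletedAlgClosure F)‖ * ‖x‖ ^ (D.deg - 1) := by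
    rw [D.algebraMap_unif_pow_deg, norm_neg]
    refine IsUltrametricDist.norm_sum_le_of_forall_le_of_nonneg (by positivity) fun i hi => ?_
    rw [Finset.mem_range] at hi
    rw [norm_mul, norm_pow]
    refine mul_le_mul (norm_algebraMap_wittFixedToF_le_of_dvd hp (D.dvd_coeff hi)) ?_ (by positivity) (norm_nonneg _)
    exact pow_le_pow_right₀ hge (by omega)
  have hlt : ‖(p : CompletedAlgClosure F)‖ * ‖x‖ ^ (D.deg - 1) < ‖x‖ ^ D.deg := by
    have hxpos : 0 < ‖x‖ := lt_of_lt_of_le one_pos hge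
    calc ‖(p : CompletedAlgClosure F)‖ * ‖x‖ ^ (D.deg - 1) < 1 * ‖x‖ ^ (D.deg - 1) := by gcongr
      _ ≤ ‖x‖ ^ D.deg := by
        rw [one_mul]
        exact pow_le_pow_right₀ hge (Nat.sub_le _ _)
  rw [norm_pow] at hbound
  exact absurd (hbound.trans_lt hlt) (lt_irrefl _)

/-- `‖c₀‖ = ‖p‖` for the constant coefficient. [cite: SerreLocalFields1979, Ch. I §6 Prop. 17] -/
theorem norm_algebraMap_coeff_zero :
    ‖algebraMap F (CompletedAlgClosure F) (wittFixedToF F p hp (D.poly.coeff 0))‖ = ‖(p : CompletedAlgClosure F)‖ := by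
  obtain ⟨u, hu⟩ := D.exists_coeff_zero_eq_mul_unit
  have h1 : wittFixedToF F p hp (D.poly.coeff 0) = (p : F) * wittFixedToF F p hp (u : wittFixed F p) := by
    rw [hu, map_mul, map_natCast]
  rw [h1, map_mul, map_natCast, norm_mul, norm_algebraMap_wittFixedToF_unit, mul_one]

/-- `π^e = -c₀ - (c₁π + ⋯ + c_{e-1}π^{e-1})`, the constant term split off. [cite: SerreLocalFields1979, Ch. I §6 Prop. 17] -/
theorem algebraMap_unif_pow_deg' :
    algebraMap F (CompletedAlgClosure F) D.unif ^ D.deg =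
      -(algebraMap F (CompletedAlgClosure F) (wittFixedToF F p hp (D.poly.coeff 0)) +
        ∑ i ∈ Finset.range D.deg \ {0}, algebraMap F (CompletedAlgClosure F) (wittFixedToF F p hp (D.poly.coeff i)) *
          algebraMap F (CompletedAlgClosure F) D.unif ^ i) := by
  have h0 : (0 : ℕ) ∈ Finset.range D.deg := Finset.mem_range.2 D.deg_pos
  have h := Finset.sum_eq_add_sum_sdiff_singleton_of_mem h0
    (fun i => algebraMap F (CompletedAlgClosure F) (wittFixedToF F p hp (D.poly.coeff i)) *
      algebraMap F (CompletedAlgClosure F) D.unif ^ i)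
  simp only [pow_zero, mul_one] at h
  rw [D.algebraMap_unif_pow_deg, h]

/-- **`‖π‖ ^ e = ‖p‖` in `ℂ_F`**: in `π^e = -(c₀ + c₁π + ⋯)` the constant term `c₀ = p·unit` strictly
dominates. [cite: SerreLocalFields1979, Ch. I §6 Prop. 17] -/
theorem norm_algebraMap_unif_pow : ‖algebraMap F (CompletedAlgClosure F) D.unif‖ ^ D.deg = ‖(p : CompletedAlgClosure F)‖ := by
  have hx1 : ‖algebraMap F (CompletedAlgClosure F) D.unif‖ < 1 := D.norm_algebraMap_unif_lt_one
  have hc0 := D.norm_algebraMap_coeff_zero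
  have hp0 : 0 < ‖(p : CompletedAlgClosure F)‖ := norm_pos_iff.2 (natCast_C_ne_zero (Fact.out : p.Prime).ne_zero)
  have htail : ‖∑ i ∈ Finset.range D.deg \ {0}, algebraMap F (CompletedAlgClosure F) (wittFixedToF F p hp (D.poly.coeff i)) *
      algebraMap F (CompletedAlgClosure F) D.unif ^ i‖ < ‖(p : CompletedAlgClosure F)‖ := by
    refine lt_of_le_of_lt (IsUltrametricDist.norm_sum_le_of_forall_le_of_nonneg
      (C := ‖(p : CompletedAlgClosure F)‖ * ‖algebraMap F (CompletedAlgClosure F) D.unif‖) (by positivity) fun i hi => ?_) ?_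
    · rw [Finset.mem_sdiff, Finset.mem_range, Finset.mem_singleton] at hi
      rw [norm_mul, norm_pow]
      refine mul_le_mul (norm_algebraMap_wittFixedToF_le_of_dvd hp (D.dvd_coeff hi.1)) ?_ (by positivity) (norm_nonneg _)
      calc ‖algebraMap F (CompletedAlgClosure F) D.unif‖ ^ i ≤ ‖algebraMap F (CompletedAlgClosure F) D.unif‖ ^ 1 :=
            pow_le_pow_of_le_one (norm_nonneg _) hx1.le (Nat.one_le_iff_ne_zero.2 hi.2)
        _ = ‖algebraMap F (CompletedAlgClosure F) D.unif‖ := pow_one _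
    · calc ‖(p : CompletedAlgClosure F)‖ * ‖algebraMap F (CompletedAlgClosure F) D.unif‖
          < ‖(p : CompletedAlgClosure F)‖ * 1 := by gcongr
        _ = _ := mul_one _
  rw [← norm_pow, D.algebraMap_unif_pow_deg', norm_neg]
  rw [← hc0] at htail ⊢
  exact IsUltrametricDist.norm_add_eq_max_of_norm_ne_norm (ne_of_gt htail) |>.trans (max_eq_left htail.le)

/-- `‖π‖ ≤ 1`: the root lies in `𝒪_{ℂ_F}`. [cite: SerreLocalFields1979, Ch. I §6 Prop. 17] -/
theorem norm_algebraMap_unif_le_one : ‖algebraMap F (CompletedAlgClosure F) D.unif‖ ≤ 1 :=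
  D.norm_algebraMap_unif_lt_one.le

/-- **The root lies in `𝒪_F`.** [cite: SerreLocalFields1979, Ch. I §6 Prop. 17] -/
theorem unif_mem_integer : D.unif ∈ 𝒪[F] := by
  have h := D.norm_algebraMap_unif_le_one
  rw [CompletedAlgClosure.norm_algebraMap] at h
  exact (norm_le_one_iff F _).mp h

/-- **The root `π ∈ 𝒪_{ℂ_F}`** (tree `integerC F`). [cite: SerreLocalFields1979, Ch. I §6 Prop. 17] -/
def unifC : integerC F := ⟨algebraMap F (CompletedAlgClosure F) D.unif, (mem_integerC_iff).2 D.norm_algebraMap_unif_le_one⟩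

/-- Unfolding `unifC`. [cite: SerreLocalFields1979, Ch. I §6 Prop. 17] -/
@[simp] theorem coe_unifC : ((D.unifC : integerC F) : CompletedAlgClosure F) = algebraMap F (CompletedAlgClosure F) D.unif := rfl

/-- `‖π‖ < 1`. [cite: SerreLocalFields1979, Ch. I §6 Prop. 17] -/
theorem norm_unifC_lt_one : ‖((D.unifC : integerC F) : CompletedAlgClosure F)‖ < 1 := D.norm_algebraMap_unif_lt_one

/-- `‖π‖ ^ e = ‖p‖`. [cite: SerreLocalFields1979, Ch. I §6 Prop. 17] -/
theorem norm_unifC_pow : ‖((D.unifC : integerC F) : CompletedAlgClosure F)‖ ^ D.deg = ‖(p : CompletedAlgClosure F)‖ :=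
  D.norm_algebraMap_unif_pow

/-- `π ≠ 0` in `ℂ_F`. [cite: SerreLocalFields1979, Ch. I §6 Prop. 17] -/
theorem coe_unifC_ne_zero : ((D.unifC : integerC F) : CompletedAlgClosure F) ≠ 0 := by
  intro h0
  have h := D.norm_unifC_pow
  rw [h0, norm_zero, zero_pow D.deg_pos.ne'] at h
  exact natCast_C_ne_zero (F := F) (Fact.out : p.Prime).ne_zero (norm_eq_zero.1 h.symm)

/-- `Γ_F` fixes `π ∈ F ⊆ ℂ_F`. [cite: SerreLocalFields1979, Ch. I §6 Prop. 17] -/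
theorem smul_coe_unifC (σ : absoluteGaloisGroup F) :
    σ • ((D.unifC : integerC F) : CompletedAlgClosure F) = ((D.unifC : integerC F) : CompletedAlgClosure F) := by
  rw [coe_unifC, CompletedAlgClosure.smul_algebraMap]

/-- `Γ_F` fixes `π ∈ 𝒪_{ℂ_F}` (tree `galInt`). [cite: SerreLocalFields1979, Ch. I §6 Prop. 17] -/
theorem galInt_unifC (σ : absoluteGaloisGroup F) : galInt σ D.unifC = D.unifC :=
  Subtype.ext (by rw [coe_galInt, smul_coe_unifC])

/-- `E(π) = 0` read in `𝒪_{ℂ_F}` along `W(k_F) → 𝒪_{ℂ_F}`. [cite: SerreLocalFields1979, Ch. I §6 Prop. 17] -/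
theorem eval₂_wittFixedToIntC_unifC : D.poly.eval₂ (wittFixedToIntC F p hp) D.unifC = 0 := by
  apply Subtype.ext
  change ((D.poly.eval₂ (wittFixedToIntC F p hp) D.unifC : integerC F) : CompletedAlgClosure F) = 0
  rw [show ((D.poly.eval₂ (wittFixedToIntC F p hp) D.unifC : integerC F) : CompletedAlgClosure F) =
      D.poly.eval₂ ((integerC F).subtype.comp (wittFixedToIntC F p hp)) (D.unifC : CompletedAlgClosure F) from
    Polynomial.hom_eval₂ _ _ (integerC F).subtype _]
  have h := congrArg (algebraMap F (CompletedAlgClosure F)) D.eval₂_unif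
  rw [Polynomial.hom_eval₂, map_zero] at h
  have hc : (integerC F).subtype.comp (wittFixedToIntC F p hp) =
      (algebraMap F (CompletedAlgClosure F)).comp (wittFixedToF F p hp) :=
    RingHom.ext fun z => coe_wittFixedToIntC hp z
  rw [coe_unifC, hc]
  exact h

/-! ## §3 The coefficient ring `𝒪_D = W(k_F)[X]/(E)` -/

/-- **The coefficient ring `𝒪_D = W(k_F)[X]/(E) ≅ W(k_F)[π]`** (Mathlib `AdjoinRoot`): the ring over which formal groups
with `𝒪_D`-coefficients are evaluated in `𝔸_inf(F)[X]/(E)`. [cite: SerreLocalFields1979, Ch. I §6 Prop. 18] -/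
abbrev Coeff : Type := AdjoinRoot D.poly

/-- **`𝒪_D → F`, `X ↦ π`.** [cite: SerreLocalFields1979, Ch. I §6 Prop. 18] -/
def Coeff.toF : D.Coeff →+* F := AdjoinRoot.lift (wittFixedToF F p hp) D.unif D.eval₂_unif

/-- `𝒪_D → F` on `W(k_F)`. [cite: SerreLocalFields1979, Ch. I §6 Prop. 18] -/
@[simp] theorem Coeff.toF_of (z : wittFixed F p) : Coeff.toF D (AdjoinRoot.of D.poly z) = wittFixedToF F p hp z :=
  AdjoinRoot.lift_of _

/-- `𝒪_D → F` on `X`. [cite: SerreLocalFields1979, Ch. I §6 Prop. 18] -/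
@[simp] theorem Coeff.toF_root : Coeff.toF D (AdjoinRoot.root D.poly) = D.unif := AdjoinRoot.lift_root _

/-- `𝒪_D → F` on a polynomial class. [cite: SerreLocalFields1979, Ch. I §6 Prop. 18] -/
theorem Coeff.toF_mk (g : (wittFixed F p)[X]) : Coeff.toF D (AdjoinRoot.mk D.poly g) = g.eval₂ (wittFixedToF F p hp) D.unif :=
  AdjoinRoot.lift_mk _ g

/-- **`𝒪_D → F` lands in `𝒪_F`** (`‖W(k_F)‖ ≤ 1`, `‖π‖ ≤ 1`). [cite: SerreLocalFields1979, Ch. I §6 Prop. 18] -/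
theorem Coeff.toF_mem_integer (x : D.Coeff) : Coeff.toF D x ∈ 𝒪[F] := by
  induction x using AdjoinRoot.induction_on with
  | ih g =>
    rw [Coeff.toF_mk, Polynomial.eval₂_eq_sum_range]
    refine Subring.sum_mem _ fun i _ => Subring.mul_mem _ (wittFixedToF_mem_integer hp _) (Subring.pow_mem _ D.unif_mem_integer _)

/-- **`𝒪_D → 𝒪_F`, `X ↦ π`.** [cite: SerreLocalFields1979, Ch. I §6 Prop. 18] -/
def Coeff.toInt : D.Coeff →+* 𝒪[F] := (Coeff.toF D).codRestrict 𝒪[F] (Coeff.toF_mem_integer D)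

/-- Unfolding `Coeff.toInt`. [cite: SerreLocalFields1979, Ch. I §6 Prop. 18] -/
@[simp] theorem Coeff.coe_toInt (x : D.Coeff) : ((Coeff.toInt D x : 𝒪[F]) : F) = Coeff.toF D x := rfl

/-- `𝒪_D → 𝒪_F` on `X` is `π`. [cite: SerreLocalFields1979, Ch. I §6 Prop. 18] -/
theorem Coeff.coe_toInt_root : ((Coeff.toInt D (AdjoinRoot.root D.poly) : 𝒪[F]) : F) = D.unif := by
  rw [Coeff.coe_toInt, Coeff.toF_root]

/-- `𝒪_D → F → ℂ_F` on `X` is `unifC`. [cite: SerreLocalFields1979, Ch. I §6 Prop. 18] -/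
theorem Coeff.algebraMap_toF_root :
    algebraMap F (CompletedAlgClosure F) (Coeff.toF D (AdjoinRoot.root D.poly)) = ((D.unifC : integerC F) : CompletedAlgClosure F) := by
  rw [Coeff.toF_root, coe_unifC]

end EisensteinRootW

end Literature.NumberTheory.PAdicHodge

end
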